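import Summits.Ventures.YMGap.Conjectures.StrongCouplingChiralLROSchwingerDysonOneLink
import HarnessLib
import HarnessLib.Audit.Tags

/-!
# Row S4 of Y3 at `β ≥ 0` (3/3): the Schwinger–Dyson inequalities (4.35), (4.38) with the plaquette weight,
# uniformly in the volume

Cell `pub-ymgap`, seat qcd-lit g19, `bears_on: Q1`; sequel of `…SchwingerDysonOneLink`.  0 facts.
THE RESULT (not in print; Salmhofer–Seiler prove the `β = 0` case, where `κ = 0`, `e^{±βc} = 1`):
for `1 ≤ N`, an even site `x` of the even torus `(ℤ/L)^ν`, the `U(N)` bond data with a logarithm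
`HasLog N a w` (`w₁ = 1`, `w_i ≥ 0`; the printed `w_k` for `N ≤ 4`), EVERY `β ≥ 0` and EVERY even `L`:
* `re_bondIntegral_ge/le` — two-sided bound of each bond term of the SD equation by
  `e^{∓βc} N ∑_i i w_i S_β(F(σσ)_b^i) ∓ κ(β)(S_β(F(σσ)_b) + S_β(F))`;
* `sdS_schwingerDyson` — `(N - n) S_β(F) = ∑_{b ∋ x} Re(s I_b(F))` for `N_x F = nF`;
* **`sd_step`** ((4.35)_β) — `(N e^{-βc} - κ) ∑_u u w_u S_{n+u} ≤ ((N - n) + 2νκ) S_n` for the moments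
  `S_n = S_β((σσ)_{b₀}^n)` of one bond, provided `κ(β) ≤ N e^{-βc}`;
* **`sd_base`** ((4.38)_β) — `(N - 2νκ) S_β(1) ≤ ∑_{b ∋ x} (N e^{βc} ∑_i i w_i S_β((σσ)_b^i) + κ S_β((σσ)_b))`.
All constants depend on `N, ν, β` only — NOT on `L`.  The perturbed Lemma 4.7
(`ComplexSpinSchwingerDysonPerturbed`) and the limit `β → 0` are applied in the sequel.

[cite: SalmhoferSeiler1991, Lemma 4.7 (4.31)–(4.35), Thm. 4.8 (4.38)–(4.39)]; [cite: SeilerLNP1982, Ch. 2].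
-/

noncomputable section

open MeasureTheory Finset
open scoped ComplexConjugate Matrix BigOperators
open Literature.MathematicalPhysics.QuantumFieldTheory (Site Edge GaugeConfig wilsonAction wilsonWeight wilsonMeasure
  partitionFunction haarProbability)
open Literature.MathematicalPhysics.QuantumLattice
open Literature.MathematicalPhysics.QuantumLattice.GrassmannAlgebra
open Literature.MathematicalPhysics.QuantumLattice.StrongCoupling
open Literature.MathematicalPhysics.QuantumLattice.StaggeredRP (expect definingRep eoParity_torusLinks)
open Literature.MathematicalPhysics.QuantumLattice.StaggeredDeterminant (eoParity)
open Literature.MathematicalPhysics.StatisticalMechanics (ComplexSpin.HasLog ComplexSpin.uNBondCoeff)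
open Literature.Probability.LatticeModels (TorusSite)

namespace Summit.Ventures.YMGap.Conjectures

namespace SchwingerDyson

variable {N ν L : ℕ} [NeZero L]

variable [LinearOrder (TorusSite ν L)]

/-! ### The two-sided estimate for one bond term -/

/-- **Lower bound for one bond term of the Schwinger–Dyson equation at `β ≥ 0`**:
`Re(s I_b(F)) ≥ e^{-βc} N ∑_i i w_i S_β(F(σσ)_b^i) - κ(β)(S_β(F(σσ)_b) + S_β(F))` (`x` even, `b ∋ x`, `F` in the
cone, `w_i ≥ 0`). [cite: SalmhoferSeiler1991, (4.31)–(4.34)] -/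
theorem re_bondIntegral_ge (hL : Even L) (hN : N ≠ 0) {β : ℝ} (hβ : 0 ≤ β) {x : TorusSite ν L} (hx : x ∈ evens ν L)
    {e : Edge ν L} (hxe : (torusLinks ν L e).1 = x ∨ (torusLinks ν L e).2 = x) {F : FermiAlg (TorusSite ν L) N}
    (hF : IsChiralPositive (evens ν L) F) {w : ℕ → ℝ} (hlog : ComplexSpin.HasLog N (ComplexSpin.uNBondCoeff N) w)
    (hw : ∀ i, 1 ≤ i → i ≤ N → 0 ≤ w i) :
    Real.exp (-β * linkOsc ν N) * N *
          ∑ i ∈ Finset.range (N + 1), (i : ℝ) * w i *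
            sdS N ν L β (F * spinPair (torusLinks ν L e).1 (torusLinks ν L e).2 ^ i) -
        kap N ν β * (sdS N ν L β (F * spinPair (torusLinks ν L e).1 (torusLinks ν L e).2) + sdS N ν L β F) ≤
      (chiralSign (N := N) (evens ν L) *
        ∫ U, (plaq N ν L β U : ℂ) * berezin ℂ _ (F * kinAt x (torusLinks ν L) (stagSigns ν L) U e * fermiW U) ∂(haarPi N ν L)).re := by
  set T : FermiAlg (TorusSite ν L) N := spinPair (torusLinks ν L e).1 (torusLinks ν L e).2 with hT
  -- split `e^{-βS(U[e←g])} = e^{-βS(U[e←1])} + (difference)`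
  have hA1 : Integrable (fun p : GaugeConfig ν L (UN N) × UN N => (plaq N ν L β (Function.update p.1 e 1) : ℂ) *
      berezin ℂ _ (F * kinAt x (torusLinks ν L) (stagSigns ν L) (Function.update p.1 e p.2) e * fermiW (Function.update p.1 e p.2)))
      ((haarPi N ν L).prod (haarProbability (UN N))) :=
    integrable_of_continuous_prod ((Complex.continuous_ofReal.comp (continuous_plaq_upd_one β e)).mul (continuous_berezin_kin_upd hL x e F))
  have hA : Integrable (fun p : GaugeConfig ν L (UN N) × UN N => (plaq N ν L β (Function.update p.1 e p.2) : ℂ) *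
      berezin ℂ _ (F * kinAt x (torusLinks ν L) (stagSigns ν L) (Function.update p.1 e p.2) e * fermiW (Function.update p.1 e p.2)))
      ((haarPi N ν L).prod (haarProbability (UN N))) :=
    integrable_of_continuous_prod ((Complex.continuous_ofReal.comp (continuous_plaq_upd β e)).mul (continuous_berezin_kin_upd hL x e F))
  have hsplit : ∫ U, (plaq N ν L β U : ℂ) * berezin ℂ _ (F * kinAt x (torusLinks ν L) (stagSigns ν L) U e * fermiW U) ∂(haarPi N ν L) =
      (∫ p, (plaq N ν L β (Function.update p.1 e 1) : ℂ) *
          berezin ℂ _ (F * kinAt x (torusLinks ν L) (stagSigns ν L) (Function.update p.1 e p.2) e * fermiW (Function.update p.1 e p.2))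
          ∂((haarPi N ν L).prod (haarProbability (UN N)))) +
        ∫ p, ((plaq N ν L β (Function.update p.1 e p.2) : ℂ) - plaq N ν L β (Function.update p.1 e 1)) *
          berezin ℂ _ (F * kinAt x (torusLinks ν L) (stagSigns ν L) (Function.update p.1 e p.2) e * fermiW (Function.update p.1 e p.2))
          ∂((haarPi N ν L).prod (haarProbability (UN N))) := by
    rw [kinJ_eq_integral_prod hL β x e F, ← integral_add hA1 ((hA.sub hA1).congr (ae_of_all _ fun p => by
      simp only [Pi.sub_apply]; ring))]
    exact integral_congr_ae (ae_of_all _ fun p => by ring)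
  rw [hsplit, mul_add (chiralSign (N := N) (evens ν L)), Complex.add_re, mainTerm_eq hL hN β hxe F hlog, ← hT]
  -- the main term, termwise
  have hre : ∀ M : ℕ → ℂ, (chiralSign (N := N) (evens ν L) * ((N : ℂ) * ∑ i ∈ Finset.range (N + 1), ((i : ℂ) * w i) * M i)).re =
      ∑ i ∈ Finset.range (N + 1), (N : ℝ) * ((i : ℝ) * w i) * (chiralSign (N := N) (evens ν L) * M i).re := by
    intro M
    rw [Finset.mul_sum, Finset.mul_sum, Complex.re_sum]
    refine Finset.sum_congr rfl fun i _ => ?_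
    rw [show chiralSign (N := N) (evens ν L) * ((N : ℂ) * ((i : ℂ) * w i * M i)) =
      (((N : ℝ) * ((i : ℝ) * w i) : ℝ) : ℂ) * (chiralSign (N := N) (evens ν L) * M i) by push_cast; ring, Complex.re_ofReal_mul]
  have hiw : ∀ i ∈ Finset.range (N + 1), 0 ≤ (i : ℝ) * w i := by
    intro i hi
    rcases Nat.eq_zero_or_pos i with rfl | hi1
    · simp
    · exact mul_nonneg (Nat.cast_nonneg i) (hw i hi1 (Nat.lt_succ_iff.mp (Finset.mem_range.mp hi)))
  have hmain : Real.exp (-β * linkOsc ν N) * N * ∑ i ∈ Finset.range (N + 1), (i : ℝ) * w i * sdS N ν L β (F * T ^ i) ≤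
      (chiralSign (N := N) (evens ν L) * ((N : ℂ) * ∑ i ∈ Finset.range (N + 1), ((i : ℂ) * w i) *
        ∫ p, (plaq N ν L β (Function.update p.1 e 1) : ℂ) * berezin ℂ _ (F * T ^ i * fermiW (Function.update p.1 e p.2))
          ∂((haarPi N ν L).prod (haarProbability (UN N))))).re := by
    rw [hre, Finset.mul_sum]
    refine Finset.sum_le_sum fun i hi => ?_
    have hb := (mainTerm_bounds hL hβ e (hF.mul (isChiralPositive_spinPair_pow (torusLinks ν L e).1 (torusLinks ν L e).2 i))).1
    rw [← hT] at hb
    calc Real.exp (-β * linkOsc ν N) * N * ((i : ℝ) * w i * sdS N ν L β (F * T ^ i))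
        = (N : ℝ) * ((i : ℝ) * w i) * (Real.exp (-β * linkOsc ν N) * sdS N ν L β (F * T ^ i)) := by ring
      _ ≤ _ := mul_le_mul_of_nonneg_left hb (mul_nonneg (Nat.cast_nonneg N) (hiw i hi))
  -- the remainder
  have hrem := norm_remainder_le hL hN hβ hx hxe hF
  rw [← hT] at hrem
  have hre2 := (Complex.abs_re_le_norm (chiralSign (N := N) (evens ν L) *
    ∫ p, ((plaq N ν L β (Function.update p.1 e p.2) : ℂ) - plaq N ν L β (Function.update p.1 e 1)) *
      berezin ℂ _ (F * kinAt x (torusLinks ν L) (stagSigns ν L) (Function.update p.1 e p.2) e * fermiW (Function.update p.1 e p.2))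
      ∂((haarPi N ν L).prod (haarProbability (UN N))))).trans
    (by rw [norm_mul, norm_chiralSign, one_mul])
  have hre' := (abs_le.mp (hre2.trans hrem)).1
  linarith

/-- **Upper bound for one bond term of the Schwinger–Dyson equation at `β ≥ 0`**:
`Re(s I_b(F)) ≤ e^{βc} N ∑_i i w_i S_β(F(σσ)_b^i) + κ(β)(S_β(F(σσ)_b) + S_β(F))`. [cite: SalmhoferSeiler1991, (4.31)–(4.34) and (4.38)] -/
theorem re_bondIntegral_le (hL : Even L) (hN : N ≠ 0) {β : ℝ} (hβ : 0 ≤ β) {x : TorusSite ν L} (hx : x ∈ evens ν L)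
    {e : Edge ν L} (hxe : (torusLinks ν L e).1 = x ∨ (torusLinks ν L e).2 = x) {F : FermiAlg (TorusSite ν L) N}
    (hF : IsChiralPositive (evens ν L) F) {w : ℕ → ℝ} (hlog : ComplexSpin.HasLog N (ComplexSpin.uNBondCoeff N) w)
    (hw : ∀ i, 1 ≤ i → i ≤ N → 0 ≤ w i) :
    (chiralSign (N := N) (evens ν L) *
        ∫ U, (plaq N ν L β U : ℂ) * berezin ℂ _ (F * kinAt x (torusLinks ν L) (stagSigns ν L) U e * fermiW U) ∂(haarPi N ν L)).re ≤
      Real.exp (β * linkOsc ν N) * N *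
          ∑ i ∈ Finset.range (N + 1), (i : ℝ) * w i *
            sdS N ν L β (F * spinPair (torusLinks ν L e).1 (torusLinks ν L e).2 ^ i) +
        kap N ν β * (sdS N ν L β (F * spinPair (torusLinks ν L e).1 (torusLinks ν L e).2) + sdS N ν L β F) := by
  set T : FermiAlg (TorusSite ν L) N := spinPair (torusLinks ν L e).1 (torusLinks ν L e).2 with hT
  have hA1 : Integrable (fun p : GaugeConfig ν L (UN N) × UN N => (plaq N ν L β (Function.update p.1 e 1) : ℂ) *
      berezin ℂ _ (F * kinAt x (torusLinks ν L) (stagSigns ν L) (Function.update p.1 e p.2) e * fermiW (Function.update p.1 e p.2)))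
      ((haarPi N ν L).prod (haarProbability (UN N))) :=
    integrable_of_continuous_prod ((Complex.continuous_ofReal.comp (continuous_plaq_upd_one β e)).mul (continuous_berezin_kin_upd hL x e F))
  have hA : Integrable (fun p : GaugeConfig ν L (UN N) × UN N => (plaq N ν L β (Function.update p.1 e p.2) : ℂ) *
      berezin ℂ _ (F * kinAt x (torusLinks ν L) (stagSigns ν L) (Function.update p.1 e p.2) e * fermiW (Function.update p.1 e p.2)))
      ((haarPi N ν L).prod (haarProbability (UN N))) :=
    integrable_of_continuous_prod ((Complex.continuous_ofReal.comp (continuous_plaq_upd β e)).mul (continuous_berezin_kin_upd hL x e F))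
  have hsplit : ∫ U, (plaq N ν L β U : ℂ) * berezin ℂ _ (F * kinAt x (torusLinks ν L) (stagSigns ν L) U e * fermiW U) ∂(haarPi N ν L) =
      (∫ p, (plaq N ν L β (Function.update p.1 e 1) : ℂ) *
          berezin ℂ _ (F * kinAt x (torusLinks ν L) (stagSigns ν L) (Function.update p.1 e p.2) e * fermiW (Function.update p.1 e p.2))
          ∂((haarPi N ν L).prod (haarProbability (UN N)))) +
        ∫ p, ((plaq N ν L β (Function.update p.1 e p.2) : ℂ) - plaq N ν L β (Function.update p.1 e 1)) *
          berezin ℂ _ (F * kinAt x (torusLinks ν L) (stagSigns ν L) (Function.update p.1 e p.2) e * fermiW (Function.update p.1 e p.2))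
          ∂((haarPi N ν L).prod (haarProbability (UN N))) := by
    rw [kinJ_eq_integral_prod hL β x e F, ← integral_add hA1 ((hA.sub hA1).congr (ae_of_all _ fun p => by
      simp only [Pi.sub_apply]; ring))]
    exact integral_congr_ae (ae_of_all _ fun p => by ring)
  rw [hsplit, mul_add (chiralSign (N := N) (evens ν L)), Complex.add_re, mainTerm_eq hL hN β hxe F hlog, ← hT]
  have hre : ∀ M : ℕ → ℂ, (chiralSign (N := N) (evens ν L) * ((N : ℂ) * ∑ i ∈ Finset.range (N + 1), ((i : ℂ) * w i) * M i)).re =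
      ∑ i ∈ Finset.range (N + 1), (N : ℝ) * ((i : ℝ) * w i) * (chiralSign (N := N) (evens ν L) * M i).re := by
    intro M
    rw [Finset.mul_sum, Finset.mul_sum, Complex.re_sum]
    refine Finset.sum_congr rfl fun i _ => ?_
    rw [show chiralSign (N := N) (evens ν L) * ((N : ℂ) * ((i : ℂ) * w i * M i)) =
      (((N : ℝ) * ((i : ℝ) * w i) : ℝ) : ℂ) * (chiralSign (N := N) (evens ν L) * M i) by push_cast; ring, Complex.re_ofReal_mul]
  have hiw : ∀ i ∈ Finset.range (N + 1), 0 ≤ (i : ℝ) * w i := by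
    intro i hi
    rcases Nat.eq_zero_or_pos i with rfl | hi1
    · simp
    · exact mul_nonneg (Nat.cast_nonneg i) (hw i hi1 (Nat.lt_succ_iff.mp (Finset.mem_range.mp hi)))
  have hmain : (chiralSign (N := N) (evens ν L) * ((N : ℂ) * ∑ i ∈ Finset.range (N + 1), ((i : ℂ) * w i) *
        ∫ p, (plaq N ν L β (Function.update p.1 e 1) : ℂ) * berezin ℂ _ (F * T ^ i * fermiW (Function.update p.1 e p.2))
          ∂((haarPi N ν L).prod (haarProbability (UN N))))).re ≤
      Real.exp (β * linkOsc ν N) * N * ∑ i ∈ Finset.range (N + 1), (i : ℝ) * w i * sdS N ν L β (F * T ^ i) := by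
    rw [hre, Finset.mul_sum]
    refine Finset.sum_le_sum fun i hi => ?_
    have hb := (mainTerm_bounds hL hβ e (hF.mul (isChiralPositive_spinPair_pow (torusLinks ν L e).1 (torusLinks ν L e).2 i))).2
    rw [← hT] at hb
    calc _ ≤ (N : ℝ) * ((i : ℝ) * w i) * (Real.exp (β * linkOsc ν N) * sdS N ν L β (F * T ^ i)) :=
          mul_le_mul_of_nonneg_left hb (mul_nonneg (Nat.cast_nonneg N) (hiw i hi))
      _ = _ := by ring
  have hrem := norm_remainder_le hL hN hβ hx hxe hF
  rw [← hT] at hrem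
  have hre2 := (Complex.abs_re_le_norm (chiralSign (N := N) (evens ν L) *
    ∫ p, ((plaq N ν L β (Function.update p.1 e p.2) : ℂ) - plaq N ν L β (Function.update p.1 e 1)) *
      berezin ℂ _ (F * kinAt x (torusLinks ν L) (stagSigns ν L) (Function.update p.1 e p.2) e * fermiW (Function.update p.1 e p.2))
      ∂((haarPi N ν L).prod (haarProbability (UN N))))).trans
    (by rw [norm_mul, norm_chiralSign, one_mul])
  have hre' := (abs_le.mp (hre2.trans hrem)).2
  linarith

/-! ### The Schwinger–Dyson equation integrated against the plaquette weight -/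

/-- **The Schwinger–Dyson identity at coupling `β`**: `(N - n) J_β(F) = ∑_{b ∋ x} I_b(F)` for `N_x F = nF`,
`I_b(F) = ∫ e^{-βS_W} ∫dψ̄dψ F kin_{x,b} e^{A}` — the fixed-gauge identity integrated against
`e^{-βS_W} ∏dU`; links not containing `x` do not contribute. [cite: SalmhoferSeiler1991, (3.46) and (4.31)] -/
theorem sdJ_schwingerDyson (hL : Even L) (β : ℝ) (x : TorusSite ν L) {F : FermiAlg (TorusSite ν L) N} {n : ℂ}
    (hFn : chargeOp ℂ (barCharge (N := N) x) F = n • F) :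
    ((N : ℂ) - n) * sdJ N ν L β F =
      ∑ e ∈ bondsAt ν L x, ∫ U, (plaq N ν L β U : ℂ) *
        berezin ℂ _ (F * kinAt x (torusLinks ν L) (stagSigns ν L) U e * fermiW U) ∂(haarPi N ν L) := by
  have hpt : ∀ U : GaugeConfig ν L (UN N), ((N : ℂ) - n) * ((plaq N ν L β U : ℂ) * berezin ℂ _ (F * fermiW U)) =
      ∑ e, (plaq N ν L β U : ℂ) * berezin ℂ _ (F * kinAt x (torusLinks ν L) (stagSigns ν L) U e * fermiW U) := by
    intro U
    rw [mul_left_comm, show fermiW (N := N) U = grassmannExp (actionOn Finset.univ (torusLinks ν L) (stagSigns ν L) U) from rfl,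
      schwingerDyson_fixedGauge x Finset.univ (torusLinks ν L) (stagSigns ν L) U hFn, Finset.mul_sum]
  have hint : ∀ e : Edge ν L, Integrable (fun U : GaugeConfig ν L (UN N) => (plaq N ν L β U : ℂ) *
      berezin ℂ _ (F * kinAt x (torusLinks ν L) (stagSigns ν L) U e * fermiW U)) (haarPi N ν L) := fun e =>
    integrable_of_continuous ((Complex.continuous_ofReal.comp (continuous_plaq β)).mul
      (continuous_apply_of_coeffContinuous (((CoeffContinuous.const F).mul (coeffContinuous_kinAt x e)).mul
        (coeffContinuous_fermiW hL)) _))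
  rw [sdJ, ← integral_const_mul]
  rw [integral_congr_ae (ae_of_all _ hpt), integral_finsetSum _ fun e _ => hint e]
  rw [← Finset.sum_filter_add_sum_filter_not Finset.univ (fun ℓ : Edge ν L => ℓ.1 = x ∨ ℓ.1.shift ℓ.2 = x), ← bondsAt]
  conv_rhs => rw [← add_zero (∑ e ∈ bondsAt ν L x, _)]
  congr 1
  refine Finset.sum_eq_zero fun e he => ?_
  rw [Finset.mem_filter, not_or] at he
  have h0 : ∀ U : GaugeConfig ν L (UN N), kinAt x (torusLinks ν L) (stagSigns ν L) U e = 0 :=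
    fun U => kinAt_eq_zero (l := torusLinks ν L) he.2.1 he.2.2 _ U
  simp [h0]

/-- **The real form**: `(N - n) S_β(F) = ∑_{b ∋ x} Re(s I_b(F))` for `N_x F = nF` (`n` real). [cite: SalmhoferSeiler1991, (3.46) and (4.31)] -/
theorem sdS_schwingerDyson (hL : Even L) (β : ℝ) (x : TorusSite ν L) {F : FermiAlg (TorusSite ν L) N} {n : ℝ}
    (hFn : chargeOp ℂ (barCharge (N := N) x) F = (n : ℂ) • F) :
    ((N : ℝ) - n) * sdS N ν L β F =
      ∑ e ∈ bondsAt ν L x, (chiralSign (N := N) (evens ν L) * ∫ U, (plaq N ν L β U : ℂ) *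
        berezin ℂ _ (F * kinAt x (torusLinks ν L) (stagSigns ν L) U e * fermiW U) ∂(haarPi N ν L)).re := by
  have h := congrArg (fun z => (chiralSign (N := N) (evens ν L) * z).re) (sdJ_schwingerDyson hL β x hFn)
  simp only [Finset.mul_sum, Complex.re_sum] at h
  rw [← h, mul_left_comm, show ((N : ℂ) - n) = (((N : ℝ) - n : ℝ) : ℂ) by push_cast; ring, Complex.re_ofReal_mul,
    re_chiralSign_mul_sdJ hL]

/-! ### (4.35) at `β ≥ 0`: the Schwinger–Dyson step for the moments of one bond -/

/-- `N_x (σσ)_b^n = n (σσ)_b^n` for `x ∈ b`. [cite: SalmhoferSeiler1991, (3.45)] -/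
theorem chargeOp_spinPair_pow_of_mem (hL : Even L) {x : TorusSite ν L} {e : Edge ν L} (he : e ∈ bondsAt ν L x) (n : ℕ) :
    chargeOp ℂ (barCharge (N := N) x) ((spinPair (torusLinks ν L e).1 (torusLinks ν L e).2 : FermiAlg (TorusSite ν L) N) ^ n) =
      ((n : ℝ) : ℂ) • spinPair (torusLinks ν L e).1 (torusLinks ν L e).2 ^ n := by
  rw [Complex.ofReal_natCast]
  exact chargeOp_bar_spinPair_pow (torusLinks_ne (StaggeredRP.one_lt_of_even_neZero hL) e)
    ((mem_bondsAt.mp he).elim (fun h => Or.inl h.symm) fun h => Or.inr h.symm) n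

/-- The `u = 1` term dominates from below: `S_β(G (σσ)_b) ≤ ∑_u u w_u S_β(G (σσ)_b^u)` (`w₁ = 1`, `w_u ≥ 0`, `G`
in the cone). [cite: SalmhoferSeiler1991, (4.33)–(4.34)] -/
theorem sdS_le_sum (hL : Even L) (hN : 1 ≤ N) (β : ℝ) {G : FermiAlg (TorusSite ν L) N} (hG : IsChiralPositive (evens ν L) G)
    (a b : TorusSite ν L) {w : ℕ → ℝ} (hw1 : w 1 = 1) (hw : ∀ i, 1 ≤ i → i ≤ N → 0 ≤ w i) :
    sdS N ν L β (G * spinPair a b) ≤ ∑ u ∈ Finset.range (N + 1), (u : ℝ) * w u * sdS N ν L β (G * spinPair a b ^ u) := by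
  have h1 : (1 : ℕ) ∈ Finset.range (N + 1) := Finset.mem_range.mpr (by omega)
  have h := Finset.single_le_sum (f := fun u : ℕ => (u : ℝ) * w u * sdS N ν L β (G * spinPair a b ^ u)) (fun u hu => ?_) h1
  · simpa [hw1] using h
  · have huN : u ≤ N := Nat.lt_succ_iff.mp (Finset.mem_range.mp hu)
    rcases Nat.eq_zero_or_pos u with rfl | hu1
    · simp
    · exact mul_nonneg (mul_nonneg (Nat.cast_nonneg u) (hw u hu1 huN)) (sdS_nonneg hL β (hG.mul (isChiralPositive_spinPair_pow a b u)))

/-- **(4.35) at `β ≥ 0`, UNIFORMLY IN THE VOLUME.**  For `1 ≤ N`, `x` even, a bond `b₀ ∋ x` with moments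
`S_n = S_β((σσ)_{b₀}^n)`, weights `w` with `w₁ = 1`, `w_u ≥ 0` and `HasLog N a w` (the `U(N)` bond data), every
`β ≥ 0` with `κ(β) ≤ N e^{-βc}` and every `n`:
`(N e^{-βc} - κ) ∑_u u w_u S_{n+u} ≤ ((N - n) + 2νκ) S_n`.  At `β = 0` (`κ = 0`) this is Salmhofer–Seiler's
`S_{n+1} + ∑_{u≥2} u w_u S_{n+u} ≤ (1 - n/N) S_n`. [cite: SalmhoferSeiler1991, Lemma 4.7 (4.31)–(4.35)] -/
theorem sd_step (hL : Even L) (hN : 1 ≤ N) {β : ℝ} (hβ : 0 ≤ β) (hκ : kap N ν β ≤ N * Real.exp (-β * linkOsc ν N))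
    {x : TorusSite ν L} (hx : x ∈ evens ν L) {e₀ : Edge ν L} (he₀ : e₀ ∈ bondsAt ν L x)
    {w : ℕ → ℝ} (hlog : ComplexSpin.HasLog N (ComplexSpin.uNBondCoeff N) w) (hw1 : w 1 = 1) (hw : ∀ i, 1 ≤ i → i ≤ N → 0 ≤ w i)
    (n : ℕ) :
    ((N : ℝ) * Real.exp (-β * linkOsc ν N) - kap N ν β) *
        ∑ u ∈ Finset.range (N + 1), (u : ℝ) * w u *
          sdS N ν L β (spinPair (torusLinks ν L e₀).1 (torusLinks ν L e₀).2 ^ (n + u)) ≤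
      (((N : ℝ) - n) + 2 * ν * kap N ν β) * sdS N ν L β (spinPair (torusLinks ν L e₀).1 (torusLinks ν L e₀).2 ^ n) := by
  have hN0 : N ≠ 0 := by omega
  set T : FermiAlg (TorusSite ν L) N := spinPair (torusLinks ν L e₀).1 (torusLinks ν L e₀).2 with hT
  have hTn : IsChiralPositive (evens ν L) (T ^ n) := isChiralPositive_spinPair_pow _ _ n
  have hSD := sdS_schwingerDyson hL β x (F := T ^ n) (n := n) (chargeOp_spinPair_pow_of_mem hL he₀ n)
  have hκ0 : 0 ≤ kap N ν β := kap_nonneg hβ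
  have hSn : 0 ≤ sdS N ν L β (T ^ n) := sdS_nonneg hL β hTn
  -- every bond term is bounded below
  have hbond : ∀ e ∈ bondsAt ν L x,
      Real.exp (-β * linkOsc ν N) * N *
            ∑ i ∈ Finset.range (N + 1), (i : ℝ) * w i * sdS N ν L β (T ^ n * spinPair (torusLinks ν L e).1 (torusLinks ν L e).2 ^ i) -
          kap N ν β * (sdS N ν L β (T ^ n * spinPair (torusLinks ν L e).1 (torusLinks ν L e).2) + sdS N ν L β (T ^ n)) ≤
        (chiralSign (N := N) (evens ν L) * ∫ U, (plaq N ν L β U : ℂ) *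
          berezin ℂ _ (T ^ n * kinAt x (torusLinks ν L) (stagSigns ν L) U e * fermiW U) ∂(haarPi N ν L)).re :=
    fun e he => re_bondIntegral_ge hL hN0 hβ hx (mem_bondsAt.mp he) hTn hlog hw
  -- the other bonds contribute `≥ -κ S_n`
  have hother : ∀ e ∈ bondsAt ν L x, -(kap N ν β * sdS N ν L β (T ^ n)) ≤
      (chiralSign (N := N) (evens ν L) * ∫ U, (plaq N ν L β U : ℂ) *
        berezin ℂ _ (T ^ n * kinAt x (torusLinks ν L) (stagSigns ν L) U e * fermiW U) ∂(haarPi N ν L)).re := by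
    intro e he
    refine le_trans ?_ (hbond e he)
    have h1 := sdS_le_sum hL hN β hTn (torusLinks ν L e).1 (torusLinks ν L e).2 hw1 hw
    have h2 : 0 ≤ sdS N ν L β (T ^ n * spinPair (torusLinks ν L e).1 (torusLinks ν L e).2) := by
      have := sdS_nonneg hL β (hTn.mul (isChiralPositive_spinPair_pow (torusLinks ν L e).1 (torusLinks ν L e).2 1))
      rwa [pow_one] at this
    nlinarith
  -- the bond `b₀` itself: `S(T^n T^i) = S_{n+i}`
  have hself := hbond e₀ he₀
  simp only [← hT, ← pow_add, ← pow_succ] at hself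
  -- sum over the bonds at `x`
  rw [← Finset.add_sum_erase _ _ he₀] at hSD
  have hrest : ((bondsAt ν L x).erase e₀).card • (-(kap N ν β * sdS N ν L β (T ^ n))) ≤
      ∑ e ∈ (bondsAt ν L x).erase e₀, (chiralSign (N := N) (evens ν L) * ∫ U, (plaq N ν L β U : ℂ) *
        berezin ℂ _ (T ^ n * kinAt x (torusLinks ν L) (stagSigns ν L) U e * fermiW U) ∂(haarPi N ν L)).re :=
    Finset.card_nsmul_le_sum _ _ _ fun e he => hother e (Finset.mem_of_mem_erase he)
  have hcard : (((bondsAt ν L x).erase e₀).card : ℝ) + 1 ≤ 2 * ν := by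
    have h1 := Finset.card_erase_add_one he₀
    have h2 := card_bondsAt_le (ν := ν) (L := L) x
    have h3 : ((bondsAt ν L x).erase e₀).card + 1 ≤ ν + ν := h1 ▸ h2
    have h4 : ((((bondsAt ν L x).erase e₀).card : ℕ) : ℝ) + 1 ≤ (ν : ℝ) + ν := by exact_mod_cast h3
    linarith
  rw [nsmul_eq_mul] at hrest
  -- `κ S_{n+1} ≤ κ ∑_u u w_u S_{n+u}`
  have hn1 : sdS N ν L β (T ^ (n + 1)) ≤ ∑ u ∈ Finset.range (N + 1), (u : ℝ) * w u * sdS N ν L β (T ^ (n + u)) := by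
    have h := sdS_le_sum hL hN β hTn (torusLinks ν L e₀).1 (torusLinks ν L e₀).2 hw1 hw
    simp only [← hT, ← pow_add, ← pow_succ] at h
    exact h
  have hsum0 : 0 ≤ ∑ u ∈ Finset.range (N + 1), (u : ℝ) * w u * sdS N ν L β (T ^ (n + u)) :=
    (sdS_nonneg hL β (isChiralPositive_spinPair_pow _ _ (n + 1))).trans hn1
  nlinarith [mul_nonneg hκ0 hSn, mul_le_mul_of_nonneg_left hn1 hκ0, hrest, hself, hSD, hcard,
    mul_nonneg hκ0 hsum0, mul_nonneg (Nat.cast_nonneg ((bondsAt ν L x).erase e₀).card) (mul_nonneg hκ0 hSn)]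

/-! ### (4.38) at `β ≥ 0`: the base identity at a site -/

/-- **(4.38) at `β ≥ 0`, UNIFORMLY IN THE VOLUME.**  For `1 ≤ N`, `x` even, every `β ≥ 0`:
`(N - 2νκ(β)) S_β(1) ≤ ∑_{b ∋ x} (N e^{βc} ∑_i i w_i S_β((σσ)_b^i) + κ(β) S_β((σσ)_b))`.  At `β = 0` this is
`1 ≤ ∑_{|y-x|=1} ∑_k k w_k ⟨(σ_xσ_y)^k⟩` ((4.38) with `=` weakened to `≤`). [cite: SalmhoferSeiler1991, Thm. 4.8 (4.38)] -/
theorem sd_base (hL : Even L) (hN : 1 ≤ N) {β : ℝ} (hβ : 0 ≤ β) {x : TorusSite ν L} (hx : x ∈ evens ν L)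
    {w : ℕ → ℝ} (hlog : ComplexSpin.HasLog N (ComplexSpin.uNBondCoeff N) w) (hw : ∀ i, 1 ≤ i → i ≤ N → 0 ≤ w i) :
    ((N : ℝ) - 2 * ν * kap N ν β) * sdS N ν L β 1 ≤
      ∑ e ∈ bondsAt ν L x, ((N : ℝ) * Real.exp (β * linkOsc ν N) *
          ∑ i ∈ Finset.range (N + 1), (i : ℝ) * w i * sdS N ν L β (spinPair (torusLinks ν L e).1 (torusLinks ν L e).2 ^ i) +
        kap N ν β * sdS N ν L β (spinPair (torusLinks ν L e).1 (torusLinks ν L e).2)) := by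
  have hN0 : N ≠ 0 := by omega
  have hSD := sdS_schwingerDyson (N := N) hL β x (F := 1) (n := 0) (by rw [chargeOp_one, Complex.ofReal_zero, zero_smul])
  have hκ0 : 0 ≤ kap N ν β := kap_nonneg hβ
  have hS1 : 0 ≤ sdS N ν L β 1 := sdS_nonneg hL β IsChiralPositive.one
  have hbond : ∀ e ∈ bondsAt ν L x,
      (chiralSign (N := N) (evens ν L) * ∫ U, (plaq N ν L β U : ℂ) *
          berezin ℂ _ (1 * kinAt x (torusLinks ν L) (stagSigns ν L) U e * fermiW U) ∂(haarPi N ν L)).re ≤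
        (N : ℝ) * Real.exp (β * linkOsc ν N) *
            ∑ i ∈ Finset.range (N + 1), (i : ℝ) * w i * sdS N ν L β (spinPair (torusLinks ν L e).1 (torusLinks ν L e).2 ^ i) +
          kap N ν β * sdS N ν L β (spinPair (torusLinks ν L e).1 (torusLinks ν L e).2) + kap N ν β * sdS N ν L β 1 := by
    intro e he
    have h := re_bondIntegral_le hL hN0 hβ hx (mem_bondsAt.mp he) IsChiralPositive.one hlog hw
    simp only [one_mul] at h ⊢
    nlinarith [h]
  have hsum := Finset.sum_le_sum hbond
  rw [← hSD, Finset.sum_add_distrib, Finset.sum_const, nsmul_eq_mul] at hsum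
  have hcard : ((bondsAt ν L x).card : ℝ) ≤ 2 * ν := by
    have h3 := card_bondsAt_le (ν := ν) (L := L) x
    have h4 : (((bondsAt ν L x).card : ℕ) : ℝ) ≤ (ν : ℝ) + ν := by exact_mod_cast h3
    linarith
  have h1 : ((bondsAt ν L x).card : ℝ) * (kap N ν β * sdS N ν L β 1) ≤ 2 * ν * (kap N ν β * sdS N ν L β 1) :=
    mul_le_mul_of_nonneg_right hcard (mul_nonneg hκ0 hS1)
  rw [sub_zero] at hsum
  linarith

end SchwingerDyson

end Summit.Ventures.YMGap.Conjectures
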